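import Literature.NumberTheory.EllipticCurves.MazurTorsionReductionProofs
import Literature.NumberTheory.EllipticCurves.KubertTwoTenProofs
import Literature.NumberTheory.EllipticCurves.KubertTwoTwelveProofs
import Literature.NumberTheory.EllipticCurves.KubertFourteenProofs
import Literature.NumberTheory.EllipticCurves.KubertFifteenProofs
import Literature.NumberTheory.EllipticCurves.KubertTwentyOneProofs
import Literature.NumberTheory.EllipticCurves.KubertTwentySevenProofs
import HarnessLib

/-!
# Mazur's "First reduction", consolidated: the torsion theorem for composite orders from the prime
# case and the five remaining Kubert leaves `16, 18, 25, 35, 49`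

Topic `NumberTheory/EllipticCurves`; a PROOFS file (theorems only, no `def`, no named fact)
assembling the tree's proved pieces of Mazur 1977, Ch. III §5, "First reduction" (p. 156: "by
virtue of the close study of rational points on modular curves of low genus made by Kubert [24] it
suffices to prove that `X₁(N)(ℚ)` is cuspidal for prime `N ≥ 11`…"): the reduction
`Mazur1977_reduction_to_primes_of_leaves` (file `MazurTorsionReductionProofs`) takes Kubert's
`ℤ/2 × ℤ/10`, `ℤ/2 × ℤ/12` results and the nine composite leaves
`n ∈ {14, 15, 16, 18, 21, 25, 27, 35, 49}` as hypotheses; of these, the tree now PROVES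
`ℤ/2 × ℤ/10` (`Kubert1976_no_two_ten_holds`), `ℤ/2 × ℤ/12` (`Kubert1976_no_two_twelve_holds`),
`n = 14` (`not_exists_addOrderOf_eq_fourteen`, `X₁(14)`), `n = 15`
(`not_exists_addOrderOf_eq_fifteen`, `X₀(15) ≅ 15a1`), `n = 21`
(`not_exists_addOrderOf_eq_twentyOne`, `X₀(21) ≅ 21a1`) and `n = 27`
(`not_exists_addOrderOf_eq_twentySeven`, `X₀(27)` + `X₁(9)`).

* **`Mazur1977_reduction_to_primes_of_five_leaves`** — the named fact
  `Mazur1977_reduction_to_primes` (file `MazurTorsion`) follows from the five remaining leaves: no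
  elliptic curve over `ℚ` has a rational point of order `n` for `n ∈ {16, 18, 25, 35, 49}`
  (Kubert 1976, Ch. IV: `X₁(16)`, `X₁(18)` of genus `2`; Kenku / Ligozat: `X₁(25)`, `X₀(35)`,
  `X₀(49)`), i.e. the fact is CLOSED MODULO these five statements.

## References

* [Mazur1977] B. Mazur, *Modular curves and the Eisenstein ideal*, Publ. Math. IHÉS 47 (1977),
  Ch. III §5, First reduction, p. 156; Thm. (7'), (8) p. 35.
* [Kubert1976] D. S. Kubert, *Universal bounds on the torsion of elliptic curves*, Proc. London
  Math. Soc. (3) 33 (1976) 193–237, Ch. IV.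
-/

noncomputable section

open scoped Classical

open WeierstrassCurve

namespace Literature.NumberTheory.EllipticCurves

/-- **Mazur's First reduction from five leaves.** If no elliptic curve over `ℚ` has a rational
point of order `n` for `n ∈ {16, 18, 25, 35, 49}`, then Mazur's torsion theorem for composite
orders follows from the prime case (`Mazur1977_reduction_to_primes`): the hypotheses
`ℤ/2 × ℤ/10`, `ℤ/2 × ℤ/12` and the leaves `n = 14, 15, 21, 27` of
`Mazur1977_reduction_to_primes_of_leaves` are discharged by the tree's theorems
`Kubert1976_no_two_ten_holds`, `Kubert1976_no_two_twelve_holds`,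
`not_exists_addOrderOf_eq_fourteen`, `…_fifteen`, `…_twentyOne`, `…_twentySeven`.
[cite: Mazur1977, Ch. III §5 p. 156 (First reduction, after Kubert); Kubert1976, Ch. IV] -/
theorem Mazur1977_reduction_to_primes_of_five_leaves
    (h : ∀ (V : WeierstrassCurve ℚ) [V.IsElliptic] (n : ℕ),
      n ∈ ({16, 18, 25, 35, 49} : Finset ℕ) → ¬ ∃ P : V.toAffine.Point, addOrderOf P = n) :
    Mazur1977_reduction_to_primes :=
  Mazur1977_reduction_to_primes_of_leaves Kubert1976_no_two_ten_holds
    Kubert1976_no_two_twelve_holds fun V _ n hn ↦ by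
    have key : ∀ m ∈ ({14, 15, 16, 18, 21, 25, 27, 35, 49} : Finset ℕ),
        m = 14 ∨ m = 15 ∨ m = 21 ∨ m = 27 ∨ m ∈ ({16, 18, 25, 35, 49} : Finset ℕ) := by decide
    rcases key n hn with rfl | rfl | rfl | rfl | hn5
    · exact not_exists_addOrderOf_eq_fourteen V
    · exact not_exists_addOrderOf_eq_fifteen V
    · exact not_exists_addOrderOf_eq_twentyOne V
    · exact not_exists_addOrderOf_eq_twentySeven V
    · exact h V n hn5

end Literature.NumberTheory.EllipticCurves

end
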